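import Summits.PneNP.PneNP.Theorems.ConvexRankGatesCliqueExtLowerBoundGRankPrimeFieldLeaf

/-!
# Route ConvexRankGates, crux `CliqueExtLowerBound` (stmt-PneNP-10682): the r8 GRANK leaf over the concrete fields `𝔽̄_p`

Support file (`--supports stmt-PneNP-10682`, registered sub-goal `grankCnfAll_iff_primeFieldLeafAll` of the line
`width-threshold-certificate-sparsity`, reshape r8, lead c12, wave 4). The r8 GRANK leaf `stub_grankCnfAll` quantifies over an
abstract gate `φ : GateFn` with `IsGRankGate (m^c) φ` (i.e. over `∃ (F : Type) [Field F]` and a matrix pencil over `F`) and,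
unlike the r7 leaf, carries NO side condition ("not narrow" is idle, r8). By the landed field normal form
`GRankPrimeField.isGRankGate_iff_algClosure_zmod` — packaged as `GRankPrimeFieldLeaf.forall_isGRankGate_iff`
(`∀ φ, IsGRankGate s φ → Q φ` ranges exactly over the explicit gates `⟨n, v ↦ decide (θ ≤ rank (K₀ + ∑_{vᵢ=1} Xᵢ Kᵢ))⟩`
with `p` prime, `d ≤ s`, `K₀, Kᵢ ∈ 𝔽̄_p^{d×d}`, `𝔽̄_p = AlgebraicClosure (ZMod p)`) — the leaf is EQUIVALENT to a fully
concrete statement with no type-valued quantifier and no abstract gate (`grankCnfAll_iff_primeFieldLeafAll`): the same proof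
as c11's r7 equivalence `GRankPrimeFieldLeaf.grankCnf_iff_primeFieldLeaf` with the narrow clause deleted. This is the form
in which a refuter picks ONE prime and ONE pencil (`d ≤ m^c`, threshold `θ`, `K₀`, `K`), and in which the GRANK child of the
r8 split may be filed. No new definitions. [folklore]
-/

-- `Summit.PneNP.PneNP.…` duplicates `PneNP` BY DESIGN (single-problem summit).
set_option linter.dupNamespace false

open Literature.Computability.Complexity Filter Finset

noncomputable section

namespace Summit.PneNP.PneNP.Theorems.CliqueExtLowerBound.WidthThreshold.GRankPrimeFieldLeafAll

open Summit.PneNP.PneNP.Theorems.CliqueExtLowerBound.GRankPrimeFieldLeaf (forall_isGRankGate_iff)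

open Classical in
/-- Registered sub-goal `grankCnfAll_iff_primeFieldLeafAll` (lead c12, wave 4): **the r8 GRANK leaf `stub_grankCnfAll`
(no side condition) is equivalent to its concrete `𝔽̄_p` form** — the same local-sandwich conclusion for the explicit
rank-threshold gate of every matrix pencil `K₀ + ∑ Xᵢ Kᵢ` over `AlgebraicClosure (ZMod p)`, `p` prime, `d ≤ m^c`
(no `∃ (F : Type)`, no abstract `φ`). Both sides thread the quantifiers `∀ c, ∃ r₀ s₀, …, ∀ r s, …, ∀ᶠ m` identically;
pointwise in `m` it is `forall_isGRankGate_iff`. [folklore] -/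
theorem grankCnfAll_iff_primeFieldLeafAll :
    (∀ c : ℕ, ∃ r₀ s₀ : ℕ, 2 ≤ r₀ ∧ 2 ≤ s₀ ∧ ∀ r s : ℕ, r₀ ≤ r → s₀ ≤ s →
    ∀ᶠ m : ℕ in atTop, ∀ φ : GateFn, IsGRankGate (m ^ c) φ →
      ∀ C : Fin φ.1 → Finset (Finset ((⊤ : SimpleGraph (Fin m)).edgeSet)),
        #(univ.image C) ≤ m ^ (c + 3) → (∀ j, ∀ S ∈ C j, #S ≤ s - 1) →
        ∃ dnf cnf : Finset (Finset ((⊤ : SimpleGraph (Fin m)).edgeSet)),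
          (∀ R ∈ dnf, #R ≤ r - 1) ∧ (∀ S ∈ cnf, #S ≤ s - 1) ∧
          (∀ x, EvalDNF dnf x → EvalCNF cnf x) ∧
          (#((posGraphs m ⌈(m : ℝ) ^ (1 / 4 : ℝ)⌉₊).filter
              (fun x => φ.2 (fun j => decide (EvalCNF (C j) x)) = true ∧ ¬ EvalDNF dnf x)) : ℝ)
            ≤ (1 / (8 * (m : ℝ) ^ (c + 1))) * #(posGraphs m ⌈(m : ℝ) ^ (1 / 4 : ℝ)⌉₊) ∧
          (#((((powersetCard (Fintype.card ((⊤ : SimpleGraph (Fin m)).edgeSet) / ⌊(m : ℝ) ^ (1 / 8 : ℝ)⌋₊)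
          (univ : Finset ((⊤ : SimpleGraph (Fin m)).edgeSet))).image (fun M => fun e => decide (e ∉ M)))).filter
              (fun x => EvalCNF cnf x ∧ φ.2 (fun j => decide (EvalCNF (C j) x)) = false)) : ℝ)
            ≤ (1 / (8 * (m : ℝ) ^ (c + 1))) *
              #(((powersetCard (Fintype.card ((⊤ : SimpleGraph (Fin m)).edgeSet) / ⌊(m : ℝ) ^ (1 / 8 : ℝ)⌋₊)
          (univ : Finset ((⊤ : SimpleGraph (Fin m)).edgeSet))).image (fun M => fun e => decide (e ∉ M))))) ↔
    (∀ c : ℕ, ∃ r₀ s₀ : ℕ, 2 ≤ r₀ ∧ 2 ≤ s₀ ∧ ∀ r s : ℕ, r₀ ≤ r → s₀ ≤ s →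
    ∀ᶠ m : ℕ in atTop, ∀ (p : ℕ) (_ : Fact p.Prime) (n d θ : ℕ), d ≤ m ^ c →
      ∀ (K₀ : Matrix (Fin d) (Fin d) (AlgebraicClosure (ZMod p)))
        (K : Fin n → Matrix (Fin d) (Fin d) (AlgebraicClosure (ZMod p))),
      ∀ C : Fin n → Finset (Finset ((⊤ : SimpleGraph (Fin m)).edgeSet)),
        #(univ.image C) ≤ m ^ (c + 3) → (∀ j, ∀ S ∈ C j, #S ≤ s - 1) →
        ∃ dnf cnf : Finset (Finset ((⊤ : SimpleGraph (Fin m)).edgeSet)),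
          (∀ R ∈ dnf, #R ≤ r - 1) ∧ (∀ S ∈ cnf, #S ≤ s - 1) ∧
          (∀ x, EvalDNF dnf x → EvalCNF cnf x) ∧
          (#((posGraphs m ⌈(m : ℝ) ^ (1 / 4 : ℝ)⌉₊).filter
              (fun x => decide (θ ≤ (symbolicMatrix K₀ K (fun j => decide (EvalCNF (C j) x))).rank) = true ∧
                ¬ EvalDNF dnf x)) : ℝ)
            ≤ (1 / (8 * (m : ℝ) ^ (c + 1))) * #(posGraphs m ⌈(m : ℝ) ^ (1 / 4 : ℝ)⌉₊) ∧
          (#((((powersetCard (Fintype.card ((⊤ : SimpleGraph (Fin m)).edgeSet) / ⌊(m : ℝ) ^ (1 / 8 : ℝ)⌋₊)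
          (univ : Finset ((⊤ : SimpleGraph (Fin m)).edgeSet))).image (fun M => fun e => decide (e ∉ M)))).filter
              (fun x => EvalCNF cnf x ∧
                decide (θ ≤ (symbolicMatrix K₀ K (fun j => decide (EvalCNF (C j) x))).rank) = false)) : ℝ)
            ≤ (1 / (8 * (m : ℝ) ^ (c + 1))) *
              #(((powersetCard (Fintype.card ((⊤ : SimpleGraph (Fin m)).edgeSet) / ⌊(m : ℝ) ^ (1 / 8 : ℝ)⌋₊)
          (univ : Finset ((⊤ : SimpleGraph (Fin m)).edgeSet))).image (fun M => fun e => decide (e ∉ M))))) := by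
  refine forall_congr' fun c => exists_congr fun r₀ => exists_congr fun s₀ => and_congr_right fun _ =>
    and_congr_right fun _ => forall_congr' fun r => forall_congr' fun s => imp_congr_right fun _ =>
    imp_congr_right fun _ => Filter.eventually_congr (Filter.Eventually.of_forall fun m => ?_)
  exact forall_isGRankGate_iff

end Summit.PneNP.PneNP.Theorems.CliqueExtLowerBound.WidthThreshold.GRankPrimeFieldLeafAll

end
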